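import Summits.ResolutionOfSingularities.ResolutionOfSingularities.Theorems.RadicialJungCleanModelsStubLeibnizObstruction
import Mathlib
import HarnessLib

/-!
# Crux stmt-ResolutionOfSingularities-15917 (`RadicialJung.CleanModels`), stub `stub_cleanSpreads`,
# part 1b: unit derivative ⇒ regular type

Support file for the stub `stub_cleanSpreads` (line `Sketch`, rev 7): the mechanism by which
cleanness of regular type is recognised at a localisation `A_𝔮` of a ring `A` of characteristic
`p`. If `E(s) ∉ 𝔮` for a derivation `E ∈ Der(A)`, then `x = s` is loosely clean of regular type at
`A_𝔮`: either `s` is a unit with `s - c^p ∉ 𝔪` for all `c`, or `s - c^p ∈ 𝔪 ∖ 𝔪²` for some `c`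
(`regularType_of_derivation_apply_notMem`; the landed `stub_leibnizObstruction`: `E` kills `p`-th
powers and maps `𝔪²` into `𝔪`). Also the bookkeeping lemma `mem_of_span_eq_maximalIdeal`.
-/

noncomputable section

set_option linter.dupNamespace false -- mandated namespace of this single-conjunct summit

open IsLocalRing

namespace Summit.ResolutionOfSingularities.ResolutionOfSingularities.Theorems.RadicialJung.CleanModels

universe u v w

/-! ## Unit derivative ⇒ regular type -/

/-- **Unit derivative ⇒ regular type, at every localisation missing the derivative.** If
`E(s) ∉ 𝔮` for a derivation `E` of `A` (characteristic `p`), then at `O' = A_𝔮` the element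
`x = s` is loosely clean of regular type: either a unit with `s - c^p ∉ 𝔪` for all `c`, or
`s - c^p ∈ 𝔪 ∖ 𝔪²` for some `c` (`stub_leibnizObstruction`: `E` kills `p`-th powers and maps
`𝔪²` into `𝔪`). -/
theorem regularType_of_derivation_apply_notMem (p : ℕ) (hp : p.Prime) {A : Type u} [CommRing A]
    [CharP A p] {K : Type w} [CommRing K] [Algebra A K] (E : Derivation ℤ A A) (s : A)
    (𝔮 : Ideal A) [𝔮.IsPrime] (hs : E s ∉ 𝔮) (x : K) (hx : x = algebraMap A K s)
    (O' : Type v) [CommRing O'] [IsLocalRing O'] [Algebra A O'] [IsLocalization.AtPrime O' 𝔮]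
    [Algebra O' K] [IsScalarTower A O' K] :
    (∃ u : O', IsUnit u ∧ x = algebraMap O' K u ∧ ∀ c' : O', u - c' ^ p ∉ maximalIdeal O') ∨
      (∃ s' c' : O', x = algebraMap O' K s' ∧
        s' - c' ^ p ∈ maximalIdeal O' ∧ s' - c' ^ p ∉ maximalIdeal O' ^ 2) := by
  have hx' : x = algebraMap O' K (algebraMap A O' s) := by
    rw [hx, IsScalarTower.algebraMap_apply A O' K]
  by_cases h : ∃ c' : O', algebraMap A O' s - c' ^ p ∈ maximalIdeal O'
  · obtain ⟨c', hc'⟩ := h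
    refine Or.inr ⟨algebraMap A O' s, c', hx', hc', ?_⟩
    exact stub_leibnizObstruction (RingHom.id A) p hp 𝔮 𝔮 (Ideal.comap_id 𝔮) E s hs c' hc'
  · push Not at h
    refine Or.inl ⟨algebraMap A O' s, ?_, hx', h⟩
    have h0 := h 0
    rw [zero_pow hp.ne_zero, sub_zero] at h0
    exact not_not.mp fun hu => h0 ((mem_maximalIdeal _).mpr (mem_nonunits_iff.mpr hu))

/-- Members of a generating family of `𝔪_{A_𝔭}` taken from `A` lie in `𝔭`. -/
theorem mem_of_span_eq_maximalIdeal {A : Type u} [CommRing A] (𝔭 : Ideal A) [𝔭.IsPrime]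
    (O : Type v) [CommRing O] [IsLocalRing O] [Algebra A O] [IsLocalization.AtPrime O 𝔭] {d : ℕ}
    (a : Fin d → A) (ha : Ideal.span (Set.range fun i => algebraMap A O (a i)) = maximalIdeal O)
    (i : Fin d) :
    a i ∈ 𝔭 :=
  (IsLocalization.AtPrime.to_map_mem_maximal_iff O 𝔭 (a i)).mp (ha ▸ Ideal.subset_span ⟨i, rfl⟩)

end Summit.ResolutionOfSingularities.ResolutionOfSingularities.Theorems.RadicialJung.CleanModels

end
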